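import Literature.NumberTheory.Automorphic.UnitaryGroupRankOneIwahoriDatum          -- ★ R5a p833132 + ED. 2 p833453 (F0P3-p01): `iwahoriDatumU3`, `_dominant`, `nbar_mul_torus_mul_unipotent_inj`
import Literature.NumberTheory.Automorphic.MaxEntryValuationHeight                  -- ★ R5c p833097 (F0P3a-p04): `EntryHeight.pairwise_disjoint_image_doubleCoset_pow`
import Literature.NumberTheory.Automorphic.IwahoriStructureTransport                -- ★ R5b-gen p833152 + ED. 2 (B-p04): `StructureTransport.*`, `exists_iwahoriDatum_comap`
import Literature.NumberTheory.Automorphic.CMLocalNonsplitBorelTransport             -- ★ R5b-cm p833070 (B-p04): `comap_localNonsplitEquiv_torusU ∕ _unipotentU ∕ _center`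
import Literature.NumberTheory.Automorphic.UnitaryGroupRankOneCartanAnyInvolution   -- ★ `exists_cartan_of_involution`
import HarnessLib

/-!
# `F0P3CMBorelIwahoriDatum` — the Iwahori datum of the Borel of `U(Φ₃)(L⁺_v)` at a NON-SPLIT place, with dominance, exhaustion, normality in
# `K₀ = U(Φ₃)(𝒪_v)`, centre, shell disjointness and (for a uniformiser ray) the Cartan decomposition — the structure package of R6

Cell `hodgecm-mathlib`, F0∕P3 «U3-mult», crux H413 (`stmt-HodgeConjecture-24833`); N5 road (in-house pay-down of the letter #109 ★
`UnitaryGroup.U3SquareIntegrableExponents` [Casselman1995, Thm. 4.4.6]); seat B-p04 (g31) for F0P3-p01 (g10)'s assembler R6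
`Theorems/F0P3U3SquareIntegrableExponentsHolds.lean`.  THEOREMS ONLY: no `def`, no instance, no notation, no `sorry`, no named fact.

THE MATHEMATICS.  At a finite place `v` of `L⁺` that does not split in the CM field `L` (one place `w ∣ v`), the carrier of the letter is
`G = U(Φ₃)(L⁺_v) = ↥(unitaryGroupOfForm (c ⊗ 1) (cmLocalForm L 3 v))` with the FIXED Borel triple `t = cmBorelTriple L 3 v = (B, T, N)`; all structure
theory is available on the ONE-PLACE MODEL `U′ = U(σ_w, Φ₃)(L_w)` (a valued field) through the isomorphism of topological groups `e := localNonsplitEquiv`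
(★ `CMLocalNonsplitBorelTransport`: `T′.comap e = T`, `N′.comap e = N`, `Z′.comap e = Z`).  For a torus element `a ∈ T` whose image `e a` is the
diagonal ray `d(α, 1, (σ_w α)⁻¹)` with `0 < |α|_w < 1` (★ F0P3a-p04's «admissible torus element ⇒ ray shape» supplies this from N5's three conditions;
★ `exists_coe_eq_diagonal_uniformizer` supplies it for a uniformiser `α = ϖ`), ★ `iwahoriDatumU3` (F0P3-p01) is an Iwahori datum for the Borel of `U′`
along `e a` (levels `U′ ∩ K_{γ₀^{j+1}}` with `γ₀ = |α|`, `N̄′ = w₀ N′ w₀`), and ★ `StructureTransport.exists_iwahoriDatum_comap` pulls it back to an Iwahori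
datum `𝓘` for `t` with `𝓘.a = a`; dominance ∕ exhaustion ∕ normality (★ `iwahoriDatumU3_dominant`), the `N`-component uniqueness (★
`nbar_mul_torus_mul_unipotent_inj`), shell disjointness modulo the centre (★ `EntryHeight.pairwise_disjoint_image_doubleCoset_pow`) and the Cartan
decomposition (★ `exists_cartan_of_involution`) transport along `e` by ★ `StructureTransport.comap_*`.

* §1 model lemmas at `w`: `charZero`, the ratio data of `d(α,1,(σα)⁻¹)` for `iwahoriDatumU3` (private), `center_le_comap_glInt` (central ⇒ `|u| = 1` scalar ⇒ integral).
* §2 **`exists_cmIwahoriDatum`** — THE PACKAGE (T1): `∃ (𝓘 : (cmBorelTriple L 3 v).IwahoriDatum) (K₀ : Subgroup G), 𝓘.a = a ∧ IsCompact K₀ ∧ IsOpen K₀ ∧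
  Z(G) ≤ K₀ ∧ (∀ n, 𝓘.K n ≤ K₀) ∧ hKK₀ ∧ haN ∧ haNbar ∧ hexh ∧ hinj ∧ (∀ n, hdisj n) ∧ K₀ = K₀′.comap e` in the binder shapes of ★
  `Representation.norm_exponent_lt_one_of_isSquareIntegrableModCenter` ∕ `isSquareIntegrableModCenter_of_forall_norm_exponent_lt_one` (R4-asm ED. 3) and of ★
  `DoubleCosetIndex.measure_image_doubleCoset_pow_le_ofReal` (R3d).
* §3 **`exists_cmIwahoriDatum_cartan`** — (T2): for a uniformiser `α = ϖ` additionally `hcartan : ∀ g, ∃ k₁ ∈ K₀, ∃ k₂ ∈ K₀, ∃ m, ∃ z ∈ Z(G), g = k₁ 𝓘.aᵐ k₂ z`.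
HONEST LABEL: HC_CM is proved only modulo the printed citations until rung 0 closes; this file is count-neutral (#109 stays UNPROVED until R6 is ★).

## References
* [Casselman1995] W. Casselman, *Introduction to the theory of admissible representations of `p`-adic reductive groups* (draft 1 May 1995), Prop. 1.4.4
  p. 14, §1.5 Lemma 1.5.1 p. 16, Thm. 4.4.6 p. 45.
* [Rogawski1990] J. D. Rogawski, *Automorphic Representations of Unitary Groups in Three Variables* (1990), §1.10 p. 9, §12.2 p. 173.
* [PlatonovRapinchuk1994] V. Platonov, A. Rapinchuk, *Algebraic Groups and Number Theory* (1994), §5.1 (the one-place model).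
* [BruhatTits1972] F. Bruhat, J. Tits, *Groupes réductifs sur un corps local I*, (4.4.3)–(4.4.4).
-/

set_option autoImplicit false
set_option linter.dupNamespace false

open scoped MatrixGroups Pointwise WithZero
open ValuativeRel Matrix
open Literature.NumberTheory Literature.NumberTheory.Automorphic Literature.NumberTheory.Automorphic.UnitaryGroup
open _root_.NumberField _root_.IsDedekindDomain

namespace Summit.HodgeConjecture.HodgeConjecture.Cruxes.H413.F0P3CMBorelIwahoriDatum

variable (L : Type) [Field L] [NumberField L] [IsCMField L] (v : HeightOneSpectrum (𝓞 ↥(maximalRealSubfield L)))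
  (w : PlacesOver L v) (hw : IsCMField.complexConj L • w.1 = w.1)

/-! ## §1 Model lemmas at the place `w` -/

omit [IsCMField L] in
/-- The local form at `w` is `Φ₃` over `L_w`. [cite: Rogawski1990, §1.10 p. 9] -/
theorem placeForm_qsForm_eq : placeForm (Rogawski1990.qsForm L) w.1 = (StdForm.antidiagonal 3).over (w.1.adicCompletion L) := by
  rw [placeForm, Rogawski1990.qsForm, antidiagOne_eq_over, StdForm.over_map]

include hw in
/-- `σ_w` is an involution. [cite: PlatonovRapinchuk1994, §5.1] -/
theorem galAdicCompletionMap_involutive (x : w.1.adicCompletion L) :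
    galAdicCompletionMap (L := L) (IsCMField.complexConj L) hw (galAdicCompletionMap (L := L) (IsCMField.complexConj L) hw x) = x :=
  galAdicCompletionMap_galAdicCompletionMap_of_smul_eq (IsCMField.complexConj L) w (IsCMField.complexConj_ne_one L) hw x

/-- **Central elements of the model are integral**: `Z(U(σ_w,Φ₃)(L_w)) ≤ U ∩ GL₃(𝒪_w)` (central ⇒ scalar `u·1` with `|u| = 1`, ★
`exists_coe_eq_scalar_of_mem_center_unitaryGroupOfForm`, ★ `EntryHeight.v_eq_one_of_coe_eq_scalar`). [cite: PlatonovRapinchuk1994, §2.3; §5.1] -/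
theorem center_le_comap_glInt :
    Subgroup.center ↥(unitaryGroupOfForm (galAdicCompletionMap (L := L) (IsCMField.complexConj L) hw) (placeForm (Rogawski1990.qsForm L) w.1)) ≤
      (glInt 3 (w.1.adicCompletion L)).comap
        (unitaryGroupOfForm (galAdicCompletionMap (L := L) (IsCMField.complexConj L) hw) (placeForm (Rogawski1990.qsForm L) w.1)).subtype := by
  intro z hz
  haveI : CharZero (w.1.adicCompletion L) := charZero_of_injective_algebraMap (algebraMap L (w.1.adicCompletion L)).injective
  have hJw := placeForm_qsForm_eq L v w
  have hσσ := galAdicCompletionMap_involutive L v w hw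
  have hσv : ∀ x, Valued.v ((galAdicCompletionMap (L := L) (IsCMField.complexConj L) hw) x) = Valued.v x :=
    fun x => valued_galAdicCompletionMap (L := L) (IsCMField.complexConj L) hw x
  have hH : ((placeForm (Rogawski1990.qsForm L) w.1).map (galAdicCompletionMap (L := L) (IsCMField.complexConj L) hw))ᵀ =
      placeForm (Rogawski1990.qsForm L) w.1 := by rw [hJw, StdForm.over_map, StdForm.transpose_over]
  have hHd : (placeForm (Rogawski1990.qsForm L) w.1).det ≠ 0 := by
    rw [hJw]; exact ((Matrix.isUnit_iff_isUnit_det _).1 ((StdForm.antidiagonal 3).isUnit_over _)).ne_zero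
  obtain ⟨u, hu⟩ := UnitaryGroup.exists_coe_eq_scalar_of_mem_center_unitaryGroupOfForm
    (galAdicCompletionMap (L := L) (IsCMField.complexConj L) hw) _ hσσ hH hHd (by norm_num) (by norm_num) hz
  have hv := EntryHeight.v_eq_one_of_coe_eq_scalar (galAdicCompletionMap (L := L) (IsCMField.complexConj L) hw) hJw hσv hu
  rw [Subgroup.mem_comap, Subgroup.coe_subtype, mem_glInt_iff]
  have hu' : (((z : ↥(unitaryGroupOfForm _ _)) : GL (Fin 3) (w.1.adicCompletion L))⁻¹) = Matrix.GeneralLinearGroup.scalar (Fin 3) u⁻¹ := by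
    rw [hu, map_inv]
  refine ⟨fun i j => ?_, fun i j => ?_⟩
  · rw [hu, Matrix.GeneralLinearGroup.coe_scalar, ← v_le_one_iff_mem_integer, Matrix.scalar_apply, Matrix.diagonal_apply]
    split_ifs
    · exact hv.le
    · rw [map_zero]; exact zero_le
  · rw [hu', Matrix.GeneralLinearGroup.coe_scalar, ← v_le_one_iff_mem_integer, Matrix.scalar_apply, Matrix.diagonal_apply]
    split_ifs
    · rw [Units.val_inv_eq_inv_val, map_inv₀, hv, inv_one]
    · rw [map_zero]; exact zero_le

/-- The ratio data of the ray `d(α, 1, (σ_w α)⁻¹)` for ★ `iwahoriDatumU3`: as `glDiagonal` of units, with all ratios `u_i/u_j` (`i < j`) of valuation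
`≤ |α|` (they are `α`, `σ_w α`, `α σ_w α`). [cite: Casselman1995, Prop. 1.4.3] [cite: Rogawski1990, §1.10 p. 9] -/
theorem exists_units_of_coe_eq_diagonal {α : w.1.adicCompletion L} (hα0 : α ≠ 0) (hα1 : Valued.v α < 1)
    (s : ↥(unitaryGroupOfForm (galAdicCompletionMap (L := L) (IsCMField.complexConj L) hw) (placeForm (Rogawski1990.qsForm L) w.1)))
    (hs : ((s : GL (Fin 3) (w.1.adicCompletion L)) : Matrix (Fin 3) (Fin 3) (w.1.adicCompletion L)) =
      Matrix.diagonal ![α, 1, (galAdicCompletionMap (L := L) (IsCMField.complexConj L) hw α)⁻¹]) :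
    ∃ u : Fin 3 → (w.1.adicCompletion L)ˣ, (s : GL (Fin 3) (w.1.adicCompletion L)) = glDiagonal 3 (w.1.adicCompletion L) u ∧
      (∀ i j : Fin 3, i < j → valuation (w.1.adicCompletion L) ((u i : w.1.adicCompletion L) * ((u j : w.1.adicCompletion L))⁻¹) ≤
        valuation (w.1.adicCompletion L) α) ∧
      valuation (w.1.adicCompletion L) α ≠ 0 ∧ valuation (w.1.adicCompletion L) α < 1 := by
  have hσv : ∀ x, Valued.v ((galAdicCompletionMap (L := L) (IsCMField.complexConj L) hw) x) = Valued.v x :=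
    fun x => valued_galAdicCompletionMap (L := L) (IsCMField.complexConj L) hw x
  have hσα0 : galAdicCompletionMap (L := L) (IsCMField.complexConj L) hw α ≠ 0 := by
    intro h; apply hα0
    have := congrArg Valued.v h
    rw [hσv, map_zero] at this
    exact (Valuation.zero_iff _).1 this
  -- valuations in the `ValuativeRel` currency
  have hvα : valuation (w.1.adicCompletion L) α < 1 := (v_lt_one_iff_valuation_lt_one α).1 hα1
  have hvσα : valuation (w.1.adicCompletion L) (galAdicCompletionMap (L := L) (IsCMField.complexConj L) hw α) =
      valuation (w.1.adicCompletion L) α := (v_eq_iff_valuation_eq _ _).1 (hσv α)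
  set u : Fin 3 → (w.1.adicCompletion L)ˣ :=
    ![Units.mk0 α hα0, 1, (Units.mk0 (galAdicCompletionMap (L := L) (IsCMField.complexConj L) hw α) hσα0)⁻¹] with hu_def
  have hu0 : ((u 0 : (w.1.adicCompletion L)ˣ) : w.1.adicCompletion L) = α := by
    simp only [hu_def, Matrix.cons_val_zero, Units.val_mk0]
  have hu1 : ((u 1 : (w.1.adicCompletion L)ˣ) : w.1.adicCompletion L) = 1 := by
    simp only [hu_def, Matrix.cons_val_one, Matrix.cons_val_zero, Units.val_one]
  have hu2 : ((u 2 : (w.1.adicCompletion L)ˣ) : w.1.adicCompletion L) = (galAdicCompletionMap (L := L) (IsCMField.complexConj L) hw α)⁻¹ := by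
    simp only [hu_def, Matrix.cons_val_two, Matrix.tail_cons, Matrix.head_cons, Units.val_inv_eq_inv_val, Units.val_mk0]
  refine ⟨u, Units.ext ?_, ?_, (Valuation.ne_zero_iff _).2 hα0, hvα⟩
  · rw [hs, coe_glDiagonal]
    congr 1
    funext k
    fin_cases k
    · exact hu0.symm
    · exact hu1.symm
    · exact hu2.symm
  · intro i j hij
    fin_cases i <;> fin_cases j
    all_goals first | exact absurd hij (by decide) | skip
    · show valuation _ (((u 0 : (w.1.adicCompletion L)ˣ) : w.1.adicCompletion L) * (((u 1 : (w.1.adicCompletion L)ˣ) : w.1.adicCompletion L))⁻¹) ≤ _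
      rw [hu0, hu1, inv_one, mul_one]
    · show valuation _ (((u 0 : (w.1.adicCompletion L)ˣ) : w.1.adicCompletion L) * (((u 2 : (w.1.adicCompletion L)ˣ) : w.1.adicCompletion L))⁻¹) ≤ _
      rw [hu0, hu2, inv_inv, map_mul, hvσα]
      calc valuation _ α * valuation _ α ≤ valuation _ α * 1 := mul_le_mul' le_rfl hvα.le
        _ = valuation _ α := mul_one _
    · show valuation _ (((u 1 : (w.1.adicCompletion L)ˣ) : w.1.adicCompletion L) * (((u 2 : (w.1.adicCompletion L)ˣ) : w.1.adicCompletion L))⁻¹) ≤ _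
      rw [hu1, hu2, inv_inv, one_mul, hvσα]


/-! ## §2 The package (T1): an Iwahori datum for `cmBorelTriple L 3 v` along a given torus element -/

set_option maxHeartbeats 1600000 in  -- the one-place model `«local» … ≃ₜ* U(σ_w,Φ₃)(L_w)` vs the CM carrier: long defeq unfoldings of `cmLocalForm`∕`qsForm` in every transported clause
/-- **THE CM IWAHORI DATUM PACKAGE (T1).**  At a non-split `v` (`w ∣ v`, `c • w = w`), for a torus element `a ∈ T(L⁺_v)` whose image in the
one-place model is the diagonal ray `d(α, 1, (σ_w α)⁻¹)` with `0 < |α|_w < 1`: there are an Iwahori datum `𝓘` for ★ `cmBorelTriple L 3 v` WITH RAY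
`𝓘.a = a` and a compact open `K₀ = U(Φ₃)(𝒪_v)` (the pull-back of `U′ ∩ GL₃(𝒪_w)`, last clause) containing the centre and every level, such that the
levels are normalised by `K₀` (`hKK₀`), `a` is dominant at every level (`haN`, `haNbar`), `N` is exhausted by the ray (`hexh`), `N`-components in `N̄·T·N`
are unique (`hinj`) and the shells `K_n aᵐ K_n Z∕Z` are pairwise disjoint (`hdisj`) — the binder shapes of ★
`Representation.norm_exponent_lt_one_of_isSquareIntegrableModCenter` ∕ `isSquareIntegrableModCenter_of_forall_norm_exponent_lt_one` and ★
`DoubleCosetIndex.measure_image_doubleCoset_pow_le_ofReal`.  Everything is ★ `iwahoriDatumU3` ∕ `iwahoriDatumU3_dominant` ∕ `nbar_mul_torus_mul_unipotent_inj`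
(F0P3-p01) and ★ `EntryHeight.pairwise_disjoint_image_doubleCoset_pow` (F0P3a-p04) on the model, pulled back along ★ `localNonsplitEquiv` by ★
`StructureTransport.*` ∕ ★ `CMLocalNonsplitBorelTransport`. [cite: Casselman1995, Prop. 1.4.4 p. 14, §1.5 Lemma 1.5.1 p. 16, Thm. 4.4.6 p. 45]
[cite: PlatonovRapinchuk1994, §5.1] [cite: Rogawski1990, §1.10 p. 9] -/
theorem exists_cmIwahoriDatum (a : ↥(torusU (conjLocal L (IsCMField.complexConj L) v) (cmLocalForm L 3 v)))
    {α : w.1.adicCompletion L} (hα0 : α ≠ 0) (hα1 : Valued.v α < 1)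
    (ha : ((((localNonsplitEquiv (IsCMField.complexConj L) (Rogawski1990.qsForm L) (IsCMField.complexConj_ne_one L) w hw) (a : ↥(unitaryGroupOfForm (conjLocal L (IsCMField.complexConj L) v) (cmLocalForm L 3 v))) : ↥(unitaryGroupOfForm (galAdicCompletionMap (L := L) (IsCMField.complexConj L) hw) (placeForm (Rogawski1990.qsForm L) w.1))) : GL (Fin 3) (w.1.adicCompletion L)) : Matrix (Fin 3) (Fin 3) (w.1.adicCompletion L)) =
      Matrix.diagonal ![α, 1, ((galAdicCompletionMap (L := L) (IsCMField.complexConj L) hw) α)⁻¹]) :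
    ∃ (𝓘 : (cmBorelTriple L 3 v).IwahoriDatum) (K₀ : Subgroup ↥(unitaryGroupOfForm (conjLocal L (IsCMField.complexConj L) v) (cmLocalForm L 3 v))),
      𝓘.a = (a : ↥(unitaryGroupOfForm (conjLocal L (IsCMField.complexConj L) v) (cmLocalForm L 3 v))) ∧ IsCompact (K₀ : Set ↥(unitaryGroupOfForm (conjLocal L (IsCMField.complexConj L) v) (cmLocalForm L 3 v))) ∧ IsOpen (K₀ : Set ↥(unitaryGroupOfForm (conjLocal L (IsCMField.complexConj L) v) (cmLocalForm L 3 v))) ∧ Subgroup.center ↥(unitaryGroupOfForm (conjLocal L (IsCMField.complexConj L) v) (cmLocalForm L 3 v)) ≤ K₀ ∧ (∀ n, 𝓘.K n ≤ K₀) ∧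
      (∀ n, ∀ k ∈ K₀, ∀ κ ∈ 𝓘.K n, k⁻¹ * κ * k ∈ 𝓘.K n) ∧
      (∀ n, ∀ x ∈ 𝓘.K n ⊓ (cmBorelTriple L 3 v).N, 𝓘.a * x * 𝓘.a⁻¹ ∈ 𝓘.K n) ∧
      (∀ n, ∀ x ∈ 𝓘.K n ⊓ 𝓘.Nbar, 𝓘.a⁻¹ * x * 𝓘.a ∈ 𝓘.K n ⊓ 𝓘.Nbar) ∧
      (∀ n, ∀ x ∈ (cmBorelTriple L 3 v).N, ∃ m : ℕ, ∀ m', m ≤ m' → 𝓘.a ^ m' * x * (𝓘.a ^ m')⁻¹ ∈ 𝓘.K n) ∧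
      (∀ nb ∈ 𝓘.Nbar, ∀ m ∈ (cmBorelTriple L 3 v).M, ∀ n ∈ (cmBorelTriple L 3 v).N, ∀ nb' ∈ 𝓘.Nbar, ∀ m' ∈ (cmBorelTriple L 3 v).M,
          ∀ n' ∈ (cmBorelTriple L 3 v).N, nb * m * n = nb' * m' * n' → n = n') ∧
      (∀ n, Pairwise (Function.onFun Disjoint fun m : ℕ =>
          (QuotientGroup.mk : ↥(unitaryGroupOfForm (conjLocal L (IsCMField.complexConj L) v) (cmLocalForm L 3 v)) → ↥(unitaryGroupOfForm (conjLocal L (IsCMField.complexConj L) v) (cmLocalForm L 3 v)) ⧸ Subgroup.center ↥(unitaryGroupOfForm (conjLocal L (IsCMField.complexConj L) v) (cmLocalForm L 3 v))) '' DoubleCoset.doubleCoset (𝓘.a ^ m) (𝓘.K n : Set ↥(unitaryGroupOfForm (conjLocal L (IsCMField.complexConj L) v) (cmLocalForm L 3 v))) (𝓘.K n))) ∧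
      (∀ k : ↥(unitaryGroupOfForm (conjLocal L (IsCMField.complexConj L) v) (cmLocalForm L 3 v)), k ∈ K₀ ↔ ((((localNonsplitEquiv (IsCMField.complexConj L) (Rogawski1990.qsForm L) (IsCMField.complexConj_ne_one L) w hw) k : ↥(unitaryGroupOfForm (galAdicCompletionMap (L := L) (IsCMField.complexConj L) hw) (placeForm (Rogawski1990.qsForm L) w.1))) : GL (Fin 3) (w.1.adicCompletion L)) ∈ glInt 3 (w.1.adicCompletion L))) := by
  haveI : CharZero (w.1.adicCompletion L) := charZero_of_injective_algebraMap (algebraMap L (w.1.adicCompletion L)).injective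
  have hJw := placeForm_qsForm_eq L v w
  have hσσ := galAdicCompletionMap_involutive L v w hw
  have hσv : ∀ x, Valued.v ((galAdicCompletionMap (L := L) (IsCMField.complexConj L) hw) x) = Valued.v x := fun x => valued_galAdicCompletionMap (L := L) (IsCMField.complexConj L) hw x
  have hσc : Continuous (galAdicCompletionMap (L := L) (IsCMField.complexConj L) hw) := continuous_galAdicCompletionMap (L := L) (IsCMField.complexConj L) hw
  -- the ray data of `e a`, the model datum and its dominance package
  obtain ⟨u, hsu, hu, hq0, hq1⟩ := exists_units_of_coe_eq_diagonal L v w hw hα0 hα1 _ ha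
  have hdom := fun j => iwahoriDatumU3_dominant (galAdicCompletionMap (L := L) (IsCMField.complexConj L) hw) hJw hσc hq0 hq1 hq0 hq1 ((localNonsplitEquiv (IsCMField.complexConj L) (Rogawski1990.qsForm L) (IsCMField.complexConj_ne_one L) w hw) (a : ↥(unitaryGroupOfForm (conjLocal L (IsCMField.complexConj L) v) (cmLocalForm L 3 v)))) u hsu hu j
  -- transport of the datum
  obtain ⟨𝓘, hNbar, ha𝓘, hK⟩ := StructureTransport.exists_iwahoriDatum_comap (localNonsplitEquiv (IsCMField.complexConj L) (Rogawski1990.qsForm L) (IsCMField.complexConj_ne_one L) w hw) (cmBorelTriple L 3 v) (borelTriple (galAdicCompletionMap (L := L) (IsCMField.complexConj L) hw) (placeForm (Rogawski1990.qsForm L) w.1) (placeForm_qsForm_eq L v w))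
    (comap_localNonsplitEquiv_torusU L v w hw) (comap_localNonsplitEquiv_unipotentU L v w hw)
    (iwahoriDatumU3 (galAdicCompletionMap (L := L) (IsCMField.complexConj L) hw) hJw hσc hq0 hq1 hq0 hq1 ((localNonsplitEquiv (IsCMField.complexConj L) (Rogawski1990.qsForm L) (IsCMField.complexConj_ne_one L) w hw) (a : ↥(unitaryGroupOfForm (conjLocal L (IsCMField.complexConj L) v) (cmLocalForm L 3 v)))) u hsu hu)
  have hsymm : (localNonsplitEquiv (IsCMField.complexConj L) (Rogawski1990.qsForm L) (IsCMField.complexConj_ne_one L) w hw).symm ((localNonsplitEquiv (IsCMField.complexConj L) (Rogawski1990.qsForm L) (IsCMField.complexConj_ne_one L) w hw) (a : ↥(unitaryGroupOfForm (conjLocal L (IsCMField.complexConj L) v) (cmLocalForm L 3 v)))) = (a : ↥(unitaryGroupOfForm (conjLocal L (IsCMField.complexConj L) v) (cmLocalForm L 3 v))) := (localNonsplitEquiv (IsCMField.complexConj L) (Rogawski1990.qsForm L) (IsCMField.complexConj_ne_one L) w hw).symm_apply_apply _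
  have ha' : 𝓘.a = (a : ↥(unitaryGroupOfForm (conjLocal L (IsCMField.complexConj L) v) (cmLocalForm L 3 v))) := by rw [ha𝓘]; exact hsymm
  have hNe : ((borelTriple (galAdicCompletionMap (L := L) (IsCMField.complexConj L) hw) (placeForm (Rogawski1990.qsForm L) w.1) (placeForm_qsForm_eq L v w)).N).comap ((localNonsplitEquiv (IsCMField.complexConj L) (Rogawski1990.qsForm L) (IsCMField.complexConj_ne_one L) w hw) : ↥(«local» L (IsCMField.complexConj L) 3 (Rogawski1990.qsForm L) v) →* ↥(unitaryGroupOfForm (galAdicCompletionMap (L := L) (IsCMField.complexConj L) hw) (placeForm (Rogawski1990.qsForm L) w.1))) = (cmBorelTriple L 3 v).N := comap_localNonsplitEquiv_unipotentU L v w hw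
  have hMe : ((borelTriple (galAdicCompletionMap (L := L) (IsCMField.complexConj L) hw) (placeForm (Rogawski1990.qsForm L) w.1) (placeForm_qsForm_eq L v w)).M).comap ((localNonsplitEquiv (IsCMField.complexConj L) (Rogawski1990.qsForm L) (IsCMField.complexConj_ne_one L) w hw) : ↥(«local» L (IsCMField.complexConj L) 3 (Rogawski1990.qsForm L) v) →* ↥(unitaryGroupOfForm (galAdicCompletionMap (L := L) (IsCMField.complexConj L) hw) (placeForm (Rogawski1990.qsForm L) w.1))) = (cmBorelTriple L 3 v).M := comap_localNonsplitEquiv_torusU L v w hw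
  refine ⟨𝓘, ((glInt 3 (w.1.adicCompletion L)).comap (unitaryGroupOfForm (galAdicCompletionMap (L := L) (IsCMField.complexConj L) hw) (placeForm (Rogawski1990.qsForm L) w.1)).subtype).comap
      ((localNonsplitEquiv (IsCMField.complexConj L) (Rogawski1990.qsForm L) (IsCMField.complexConj_ne_one L) w hw) : ↥(«local» L (IsCMField.complexConj L) 3 (Rogawski1990.qsForm L) v) →* ↥(unitaryGroupOfForm (galAdicCompletionMap (L := L) (IsCMField.complexConj L) hw) (placeForm (Rogawski1990.qsForm L) w.1))), ha', ?_, ?_, ?_, ?_, ?_, ?_, ?_, ?_, ?_, ?_, fun k => Iff.rfl⟩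
  · -- compact
    exact StructureTransport.isCompact_coe_comap (localNonsplitEquiv (IsCMField.complexConj L) (Rogawski1990.qsForm L) (IsCMField.complexConj_ne_one L) w hw) (isCompact_comap_glInt (galAdicCompletionMap (L := L) (IsCMField.complexConj L) hw) hσc)
  · -- open
    exact StructureTransport.isOpen_coe_comap (localNonsplitEquiv (IsCMField.complexConj L) (Rogawski1990.qsForm L) (IsCMField.complexConj_ne_one L) w hw) ((isOpen_glInt 3 (w.1.adicCompletion L)).preimage continuous_subtype_val)
  · -- centre
    exact StructureTransport.center_le_comap (localNonsplitEquiv (IsCMField.complexConj L) (Rogawski1990.qsForm L) (IsCMField.complexConj_ne_one L) w hw) (center_le_comap_glInt L v w hw)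
  · -- levels inside `K₀`
    intro n x hx
    rw [hK n] at hx
    exact congruenceGL_le_glInt _ hx
  · -- normality
    intro n k hk κ hκ
    rw [hK n] at hκ ⊢
    exact StructureTransport.comap_normal (localNonsplitEquiv (IsCMField.complexConj L) (Rogawski1990.qsForm L) (IsCMField.complexConj_ne_one L) w hw) (hdom n).2.2.2 k hk κ hκ
  · -- `haN`
    intro n x hx
    rw [hK n, ← hNe] at hx
    have h1 := StructureTransport.comap_conj_mem (localNonsplitEquiv (IsCMField.complexConj L) (Rogawski1990.qsForm L) (IsCMField.complexConj_ne_one L) w hw) (hdom n).1 x hx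
    rw [hsymm] at h1
    rw [hK n, ha']
    exact h1
  · -- `haNbar`
    intro n x hx
    rw [hK n, hNbar] at hx
    have h1 := StructureTransport.comap_inv_conj_mem_inf (localNonsplitEquiv (IsCMField.complexConj L) (Rogawski1990.qsForm L) (IsCMField.complexConj_ne_one L) w hw) (hdom n).2.1 x hx
    rw [hsymm] at h1
    rw [hK n, hNbar, ha']
    exact h1
  · -- `hexh`
    intro n x hx
    rw [← hNe] at hx
    obtain ⟨m, hm⟩ := StructureTransport.comap_exhaustion (localNonsplitEquiv (IsCMField.complexConj L) (Rogawski1990.qsForm L) (IsCMField.complexConj_ne_one L) w hw) (hdom n).2.2.1 x hx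
    refine ⟨m, fun m' hm' => ?_⟩
    have h1 := hm m' hm'
    rw [hsymm] at h1
    rw [hK n, ha']
    exact h1
  · -- `hinj`
    intro nb hnb m hm n hn nb' hnb' m' hm' n' hn' h
    rw [hNbar] at hnb hnb'
    rw [← hMe] at hm hm'
    rw [← hNe] at hn hn'
    exact StructureTransport.comap_hinj (localNonsplitEquiv (IsCMField.complexConj L) (Rogawski1990.qsForm L) (IsCMField.complexConj_ne_one L) w hw) (nbar_mul_torus_mul_unipotent_inj (galAdicCompletionMap (L := L) (IsCMField.complexConj L) hw) hJw) nb hnb m hm n hn nb' hnb' m' hm' n' hn' h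
  · -- `hdisj`
    intro n
    have hK' : (iwahoriDatumU3 (galAdicCompletionMap (L := L) (IsCMField.complexConj L) hw) hJw hσc hq0 hq1 hq0 hq1 ((localNonsplitEquiv (IsCMField.complexConj L) (Rogawski1990.qsForm L) (IsCMField.complexConj_ne_one L) w hw) (a : ↥(unitaryGroupOfForm (conjLocal L (IsCMField.complexConj L) v) (cmLocalForm L 3 v)))) u hsu hu).K n ≤
        (glInt 3 (w.1.adicCompletion L)).comap (unitaryGroupOfForm (galAdicCompletionMap (L := L) (IsCMField.complexConj L) hw) (placeForm (Rogawski1990.qsForm L) w.1)).subtype :=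
      fun x hx => congruenceGL_le_glInt _ hx
    have h := EntryHeight.pairwise_disjoint_image_doubleCoset_pow (galAdicCompletionMap (L := L) (IsCMField.complexConj L) hw) hJw hσσ hσv (by norm_num) (by norm_num) hα0 hα1
      ((localNonsplitEquiv (IsCMField.complexConj L) (Rogawski1990.qsForm L) (IsCMField.complexConj_ne_one L) w hw) (a : ↥(unitaryGroupOfForm (conjLocal L (IsCMField.complexConj L) v) (cmLocalForm L 3 v)))) ha _ hK'
    have h2 := StructureTransport.comap_pairwise_disjoint_image_mk (localNonsplitEquiv (IsCMField.complexConj L) (Rogawski1990.qsForm L) (IsCMField.complexConj_ne_one L) w hw) h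
    rw [hsymm, ← hK n, ← ha'] at h2
    exact h2

/-! ## §3 (T2) The uniformiser ray: the package with the Cartan decomposition -/

set_option maxHeartbeats 800000 in  -- same defeq unfoldings as (T1)
/-- **THE CM IWAHORI DATUM PACKAGE WITH THE CARTAN DECOMPOSITION (T2)**: when moreover `α = ϖ` is a UNIFORMISER of `L_w` (`|ϖ|_w = exp(-1)`;
`a` with `e a = d(ϖ, 1, (σ_w ϖ)⁻¹)` exists by ★ `exists_coe_eq_diagonal_uniformizer`), the package of `exists_cmIwahoriDatum` holds together with the
Cartan decomposition `G = ⋃ₘ K₀ 𝓘.aᵐ K₀ Z(G)` in the `hcartan` shape of ★ `Representation.isSquareIntegrableModCenter_of_forall_norm_exponent_lt_one`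
(★ `exists_cartan_of_involution` on the model — ramified `L_w ∕ L⁺_v` and residue characteristic `2` included — pulled back by ★
`StructureTransport.comap_cartan`). [cite: Casselman1995, Thm. 4.4.6 p. 45] [cite: BruhatTits1972, (4.4.3)] [cite: PlatonovRapinchuk1994, §5.1] -/
theorem exists_cmIwahoriDatum_cartan (a : ↥(torusU (conjLocal L (IsCMField.complexConj L) v) (cmLocalForm L 3 v)))
    {ϖ : w.1.adicCompletion L} (hϖ0 : ϖ ≠ 0) (hϖ : Valued.v ϖ = WithZero.exp (-1 : ℤ))
    (ha : ((((localNonsplitEquiv (IsCMField.complexConj L) (Rogawski1990.qsForm L) (IsCMField.complexConj_ne_one L) w hw) (a : ↥(unitaryGroupOfForm (conjLocal L (IsCMField.complexConj L) v) (cmLocalForm L 3 v))) : ↥(unitaryGroupOfForm (galAdicCompletionMap (L := L) (IsCMField.complexConj L) hw) (placeForm (Rogawski1990.qsForm L) w.1))) : GL (Fin 3) (w.1.adicCompletion L)) : Matrix (Fin 3) (Fin 3) (w.1.adicCompletion L)) =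
      Matrix.diagonal ![ϖ, 1, ((galAdicCompletionMap (L := L) (IsCMField.complexConj L) hw) ϖ)⁻¹]) :
    ∃ (𝓘 : (cmBorelTriple L 3 v).IwahoriDatum) (K₀ : Subgroup ↥(unitaryGroupOfForm (conjLocal L (IsCMField.complexConj L) v) (cmLocalForm L 3 v))),
      (𝓘.a = (a : ↥(unitaryGroupOfForm (conjLocal L (IsCMField.complexConj L) v) (cmLocalForm L 3 v))) ∧ IsCompact (K₀ : Set ↥(unitaryGroupOfForm (conjLocal L (IsCMField.complexConj L) v) (cmLocalForm L 3 v))) ∧ IsOpen (K₀ : Set ↥(unitaryGroupOfForm (conjLocal L (IsCMField.complexConj L) v) (cmLocalForm L 3 v))) ∧ Subgroup.center ↥(unitaryGroupOfForm (conjLocal L (IsCMField.complexConj L) v) (cmLocalForm L 3 v)) ≤ K₀ ∧ (∀ n, 𝓘.K n ≤ K₀) ∧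
      (∀ n, ∀ k ∈ K₀, ∀ κ ∈ 𝓘.K n, k⁻¹ * κ * k ∈ 𝓘.K n) ∧
      (∀ n, ∀ x ∈ 𝓘.K n ⊓ (cmBorelTriple L 3 v).N, 𝓘.a * x * 𝓘.a⁻¹ ∈ 𝓘.K n) ∧
      (∀ n, ∀ x ∈ 𝓘.K n ⊓ 𝓘.Nbar, 𝓘.a⁻¹ * x * 𝓘.a ∈ 𝓘.K n ⊓ 𝓘.Nbar) ∧
      (∀ n, ∀ x ∈ (cmBorelTriple L 3 v).N, ∃ m : ℕ, ∀ m', m ≤ m' → 𝓘.a ^ m' * x * (𝓘.a ^ m')⁻¹ ∈ 𝓘.K n) ∧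
      (∀ nb ∈ 𝓘.Nbar, ∀ m ∈ (cmBorelTriple L 3 v).M, ∀ n ∈ (cmBorelTriple L 3 v).N, ∀ nb' ∈ 𝓘.Nbar, ∀ m' ∈ (cmBorelTriple L 3 v).M,
          ∀ n' ∈ (cmBorelTriple L 3 v).N, nb * m * n = nb' * m' * n' → n = n') ∧
      (∀ n, Pairwise (Function.onFun Disjoint fun m : ℕ =>
          (QuotientGroup.mk : ↥(unitaryGroupOfForm (conjLocal L (IsCMField.complexConj L) v) (cmLocalForm L 3 v)) → ↥(unitaryGroupOfForm (conjLocal L (IsCMField.complexConj L) v) (cmLocalForm L 3 v)) ⧸ Subgroup.center ↥(unitaryGroupOfForm (conjLocal L (IsCMField.complexConj L) v) (cmLocalForm L 3 v))) '' DoubleCoset.doubleCoset (𝓘.a ^ m) (𝓘.K n : Set ↥(unitaryGroupOfForm (conjLocal L (IsCMField.complexConj L) v) (cmLocalForm L 3 v))) (𝓘.K n))) ∧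
      (∀ k : ↥(unitaryGroupOfForm (conjLocal L (IsCMField.complexConj L) v) (cmLocalForm L 3 v)), k ∈ K₀ ↔ ((((localNonsplitEquiv (IsCMField.complexConj L) (Rogawski1990.qsForm L) (IsCMField.complexConj_ne_one L) w hw) k : ↥(unitaryGroupOfForm (galAdicCompletionMap (L := L) (IsCMField.complexConj L) hw) (placeForm (Rogawski1990.qsForm L) w.1))) : GL (Fin 3) (w.1.adicCompletion L)) ∈ glInt 3 (w.1.adicCompletion L)))) ∧
      (∀ g : ↥(unitaryGroupOfForm (conjLocal L (IsCMField.complexConj L) v) (cmLocalForm L 3 v)), ∃ k₁ ∈ K₀, ∃ k₂ ∈ K₀, ∃ m : ℕ, ∃ z ∈ Subgroup.center ↥(unitaryGroupOfForm (conjLocal L (IsCMField.complexConj L) v) (cmLocalForm L 3 v)), g = k₁ * 𝓘.a ^ m * k₂ * z) := by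
  have hϖ1 : Valued.v ϖ < 1 := by
    rw [hϖ, ← WithZero.exp_zero]
    exact WithZero.exp_lt_exp.2 (by norm_num)
  obtain ⟨𝓘, K₀, hpack⟩ := exists_cmIwahoriDatum L v w hw a hϖ0 hϖ1 ha
  refine ⟨𝓘, K₀, hpack, ?_⟩
  obtain ⟨ha', -, -, -, -, -, -, -, -, -, -, hiff⟩ := hpack
  have hJw := placeForm_qsForm_eq L v w
  have hσσ := galAdicCompletionMap_involutive L v w hw
  have hσv : ∀ x, Valued.v ((galAdicCompletionMap (L := L) (IsCMField.complexConj L) hw) x) = Valued.v x := fun x => valued_galAdicCompletionMap (L := L) (IsCMField.complexConj L) hw x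
  have hc := StructureTransport.comap_cartan (localNonsplitEquiv (IsCMField.complexConj L) (Rogawski1990.qsForm L) (IsCMField.complexConj_ne_one L) w hw)
    (K₀' := (glInt 3 (w.1.adicCompletion L)).comap (unitaryGroupOfForm (galAdicCompletionMap (L := L) (IsCMField.complexConj L) hw) (placeForm (Rogawski1990.qsForm L) w.1)).subtype)
    (fun g => exists_cartan_of_involution (galAdicCompletionMap (L := L) (IsCMField.complexConj L) hw) hJw hσσ hσv hϖ ((localNonsplitEquiv (IsCMField.complexConj L) (Rogawski1990.qsForm L) (IsCMField.complexConj_ne_one L) w hw) (a : ↥(unitaryGroupOfForm (conjLocal L (IsCMField.complexConj L) v) (cmLocalForm L 3 v)))) ha g)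
  intro g
  obtain ⟨k₁, hk₁, k₂, hk₂, m, z, hz, hg⟩ := hc g
  refine ⟨k₁, (hiff k₁).2 (Subgroup.mem_comap.1 (Subgroup.mem_comap.1 hk₁)), k₂, (hiff k₂).2 (Subgroup.mem_comap.1 (Subgroup.mem_comap.1 hk₂)),
    m, z, hz, ?_⟩
  rw [ContinuousMulEquiv.symm_apply_apply] at hg
  rw [ha']
  exact hg

end Summit.HodgeConjecture.HodgeConjecture.Cruxes.H413.F0P3CMBorelIwahoriDatum
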